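import Literature.AlgebraicGeometry.HodgeTheory.BettiUniverseCMAction
import HarnessLib

/-!
# The CM type read on `H¹(A(ℂ); ℚ)`: eigenlines, the `(1,0)`-eigenlines, the rank of `H¹`, and the integral endomorphisms — over the Betti realization

Family `hodge`, layer `Literature/AlgebraicGeometry/HodgeTheory`, sub-namespace
`Literature.AlgebraicGeometry.HodgeTheory.BettiUniverse` (continued from `BettiUniverseAxioms`,
`BettiUniverseCMAction`).

For a smooth projective `A/ℂ` with a ring action `θ : K → End_ℂ H¹(A(ℂ); ℂ)` of a number field `K`
induced on `𝓞_K` by endomorphisms of `A` (`BettiUniverse.IsInducedOnIntegers θ`),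
`BettiUniverseCMAction` descended `θ` to the rational CM action
`cmEndAction θ hθ hHD hI hA : EndAction (hodge hHD hA 1) K` (LIGHT form: `hHD : exists_isReal_hodgeModel`,
`hI : hodgePQ_independent_of_hodgeModel` explicit, both theorems of the tree). This file reads the remaining clauses of the
tree's record `PicardCM.CMAbelianVarietyRealised` (iii) — stated here in their literal unfolded
shapes, so that a consumer passes the record's components unchanged — on the rational side:

* `BettiUniverse.finrank_eigenLine_eq_one` — if the `σ`-eigenline
  `⨅ₐ ker(θ(a) − σ(a))` of `θ` is a line, so is the joint `σ`-eigenspace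
  `⨅ₑ ker((ι e) ⊗ ℂ − σ(e))` of the complexified rational action (they correspond under
  `β : ℂ ⊗_ℚ H¹(ℚ) ≃ H¹(ℂ)`, `map_eigenspaces_cmEndAction`);
* `BettiUniverse.eigenPiece_one_zero_eq_eigenLine` — if the `σ`-eigenline of `θ` consists of classes
  of type `(1,0)`, the `(1,0)`-eigen-piece `V^{1,0}_σ = V^{1,0} ∩ ⨅ₑ ker((ι e) ⊗ ℂ − σ(e))` of
  `cmEndAction` IS the whole joint eigenspace; `BettiUniverse.eigenPiece_one_zero_eq_bot` — if it
  consists of classes of type `(0,1)`, the `(1,0)`-eigen-piece is `0` (a class of types `(1,0)` and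
  `(0,1)` at once vanishes: distinct Hodge pieces are disjoint, `disjoint_hodge_piece`). Together: **the CM-type condition**
  `H^{1,0}(A) = ⊕_{σ ∈ Φ} H¹(A; ℂ)_σ` in the form an axiomatic consumer records it
  (`σ ∈ Φ → V^{1,0}_σ = V_σ`, `σ ∉ Φ → V^{1,0}_σ = 0`);
* `BettiUniverse.finrank_bettiCohomology_one_eq` — `dim_ℚ H¹(A(ℂ); ℚ) = [K : ℚ]` from
  `dim_ℂ H¹(A(ℂ); ℂ) = [K : ℚ]`;
* `BettiUniverse.iInf_eigenspace_comp_ringEquiv` — reindexing of eigenlines along `e : K ≃+* E`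
  (`θ ∘ e`, `σ ∘ e`), for consumers that code the CM field by an isomorphic subfield of `ℂ`;
* `BettiUniverse.exists_pull_eq_cmEndAction` — every `a ∈ 𝓞_K` acts on `H¹(A(ℂ); ℚ)` as the
  pull-back `f^*` by an endomorphism `f : A ⟶ A` (the one inducing `θ(a)`), i.e.
  `pull f 1 = (cmEndAction θ hθ hHD hI hA).ι a`.

All `theorem`s; no definition, no named fact introduced (D-0026); `hHD`, `hI` and the clauses of (iii)
enter only as explicit hypotheses in their recorded shapes.

## References

* [Shimura1998] G. Shimura, Abelian Varieties with Complex Multiplication and Modular Functions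
  (Princeton Math. Series 46, 1998), §3.2 pp. 20–22 (rational vs analytic representation,
  `M ~ S ⊕ S̄`), §5.2 pp. 36–37 (the type on holomorphic one-forms), §6.2 Thm. 3 pp. 41–42.
* [Deligne1982HodgeCycles] P. Deligne, Hodge cycles on abelian varieties, LNM 900 (1982), §4–§5
  (`E`-actions on Hodge structures, eigen-decomposition `V ⊗ ℂ = ⊕_σ V_σ`, CM types).
* [MoonenZarhin1995] B. Moonen, Yu. Zarhin, Duke Math. J. 77 (1995), §2.2.
* [VoisinHodgeI2002] C. Voisin, Hodge Theory and Complex Algebraic Geometry I (CUP 2002), §6.1.3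
  Cor. 6.14, §7.1.1.
-/

noncomputable section

open scoped TensorProduct
open CategoryTheory Module
open Literature.AlgebraicTopology.SingularHomology
open Literature.AlgebraicGeometry.Motives (bettiCohomology ofRatClassBaseChange)
open NumberField

namespace Literature.AlgebraicGeometry.HodgeTheory

namespace BettiUniverse

section CMTypes

variable {g : ℕ} {A : Motives.SchemeOver ℂ} {K : Type} [Field K] [NumberField K]
variable (θ : K →+* Module.End ℂ (complexBetti A 1)) (hθ : IsInducedOnIntegers θ)

omit [NumberField K] in
/-- Reindexing a joint eigenspace along a field isomorphism `e : K ≃+* E`: the `σ ∘ e`-eigenline of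
`θ ∘ e` is the `σ`-eigenline of `θ` (for a consumer whose number field is CODED by an isomorphic
one). [folklore] -/
theorem iInf_eigenspace_comp_ringEquiv {E M : Type*} [Field E] [AddCommGroup M] [Module ℂ M]
    (θ' : E →+* Module.End ℂ M) (e : K ≃+* E) (σ : E →+* ℂ) :
    (⨅ a : K, Module.End.eigenspace ((θ'.comp e.toRingHom) a) ((σ.comp e.toRingHom) a)) =
      ⨅ b : E, Module.End.eigenspace (θ' b) (σ b) :=
  e.surjective.iInf_comp fun b ↦ Module.End.eigenspace (θ' b) (σ b)

/-- **The joint `σ`-eigenspace of the complexified rational CM action is a line** if the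
`σ`-eigenline `⨅ₐ ker(θ(a) − σ(a))` of `θ` is one (clause `finrank (eigenline θ σ) = 1` of the tree's
record (iii), in its unfolded shape): the two correspond under `β` (`map_eigenspaces_cmEndAction`).
Shimura §3.2: `H¹(A; ℂ) = ⊕_σ H¹_σ` with one-dimensional summands for `[K:ℚ] = 2 dim A`.
[cite: Shimura1998, §3.2, pp. 20–22] [cite: Deligne1982HodgeCycles, §4] -/
theorem finrank_eigenLine_eq_one (hHD : exists_isReal_hodgeModel) (hI : hodgePQ_independent_of_hodgeModel)
    (hA : Motives.IsSmoothProjective g A) (σ : K →+* ℂ)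
    (hσ : Module.finrank ℂ ↥(⨅ a : K, Module.End.eigenspace (θ a) (σ a)) = 1) :
    Module.finrank ℂ
        ↥(⨅ e : K, Module.End.eigenspace (((cmEndAction θ hθ hHD hI hA).ι e).baseChange ℂ) (σ e)) = 1 := by
  rw [finrank_eigenspaces_cmEndAction, hσ]

/-- The joint `σ`-eigenspace of the complexified rational action is carried by `β` INTO the
`σ`-eigenline of `θ` (elementwise form of `map_eigenspaces_cmEndAction`). [folklore] -/
theorem ofRatClassBaseChange_mem_eigenline (hHD : exists_isReal_hodgeModel)
    (hI : hodgePQ_independent_of_hodgeModel) (hA : Motives.IsSmoothProjective g A) (σ : K →+* ℂ)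
    {t : ℂ ⊗[ℚ] bettiCohomology A 1}
    (ht : t ∈ ⨅ e : K, Module.End.eigenspace (((cmEndAction θ hθ hHD hI hA).ι e).baseChange ℂ) (σ e)) :
    ofRatClassBaseChange (Motives.ComplexPoints A) 1 t ∈
      ⨅ a : K, Module.End.eigenspace (θ a) (σ a) := by
  rw [← map_eigenspaces_cmEndAction θ hθ hHD hI hA σ, ← ofRatClassBaseChangeEquiv_apply hA]
  exact Submodule.mem_map_of_mem ht

/-- **`σ ∈ Φ`: the `(1,0)`-eigen-piece is the whole `σ`-eigenspace.** If every class in the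
`σ`-eigenline of `θ` has Hodge type `(1,0)` (clause `σ ∈ Φ → ∀ v ∈ eigenline θ σ, IsOfHodgeType … 1 1 0 v`
of (iii)), then `V^{1,0}_σ := V^{1,0} ∩ V_σ = V_σ` for the rational action `cmEndAction`
(`V^{1,0} = (hodge hHD hA 1).piece 1 0` recognised by `mem_hodge_piece_one_zero_iff`). Shimura §5.2: the
holomorphic one-forms `ω_i` with `ι(α)^* ω_i = α^{φ_i} ω_i` span `𝔇₀(A) = H^{1,0}`.
[cite: Shimura1998, §5.2, pp. 36–37] [cite: Deligne1982HodgeCycles, §5] -/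
theorem eigenPiece_one_zero_eq_eigenLine (hHD : exists_isReal_hodgeModel)
    (hI : hodgePQ_independent_of_hodgeModel) (hA : Motives.IsSmoothProjective g A) (σ : K →+* ℂ)
    (h10 : ∀ v ∈ ⨅ a : K, Module.End.eigenspace (θ a) (σ a), IsOfHodgeType g A 1 1 0 v) :
    (cmEndAction θ hθ hHD hI hA).eigenPiece σ 1 0 =
      ⨅ e : K, Module.End.eigenspace (((cmEndAction θ hθ hHD hI hA).ι e).baseChange ℂ) (σ e) := by
  refine inf_eq_right.2 fun t ht ↦ ?_
  exact (mem_hodge_piece_one_zero_iff hHD hI hA t).2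
    (h10 _ (ofRatClassBaseChange_mem_eigenline θ hθ hHD hI hA σ ht))

/-- **Distinct Hodge pieces are disjoint**: for `(p,q) ≠ (p',q')` on the antidiagonal of `k`,
`V^{p,q} ∩ V^{p',q'} = 0` in `hodge hHD hX k` (the pieces `Θ'⁻¹(H^{p,q})` form an independent family —
the Hodge decomposition, `HodgeModel.iSupIndep_ratPiece`). [cite: VoisinHodgeI2002, §6.1.3 Cor. 6.14] -/
theorem disjoint_hodge_piece {n : ℕ} {X : Motives.SchemeOver ℂ} (hHD : exists_isReal_hodgeModel)
    (hX : Motives.IsSmoothProjective n X)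
    {k p q p' q' : ℕ} (hpq : p + q = k) (hpq' : p' + q' = k) (hne : (p, q) ≠ (p', q')) :
    Disjoint ((hodge hHD hX k).piece p q) ((hodge hHD hX k).piece p' q') := by
  change Disjoint (((realHodgeModel hHD hX).hodgeStructure hX (realHodgeModel_isHodgeSymmetric hHD hX) k).piece p q)
    (((realHodgeModel hHD hX).hodgeStructure hX (realHodgeModel_isHodgeSymmetric hHD hX) k).piece p' q')
  rw [(realHodgeModel hHD hX).piece_eq_ratPiece hX (realHodgeModel_isHodgeSymmetric hHD hX) hpq,
    (realHodgeModel hHD hX).piece_eq_ratPiece hX (realHodgeModel_isHodgeSymmetric hHD hX) hpq']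
  exact ((realHodgeModel hHD hX).iSupIndep_ratPiece hX k).pairwiseDisjoint
    (i := ⟨(p, q), Finset.HasAntidiagonal.mem_antidiagonal.2 hpq⟩)
    (j := ⟨(p', q'), Finset.HasAntidiagonal.mem_antidiagonal.2 hpq'⟩)
    (fun h ↦ hne (congrArg Subtype.val h))

/-- **`σ ∉ Φ`: the `(1,0)`-eigen-piece vanishes.** If every class in the `σ`-eigenline of `θ` has
Hodge type `(0,1)` (clause `σ ∉ Φ → ∀ v ∈ eigenline θ σ, IsOfHodgeType … 1 0 1 v` of (iii)), then
`V^{1,0}_σ = 0`: an element of `V^{1,0} ∩ V_σ` lies in `V^{1,0}` and (its `β`-image having type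
`(0,1)`) in `V^{0,1}`, and `V^{1,0} ∩ V^{0,1} = 0` (Voisin I Cor. 6.14).
[cite: Shimura1998, §5.2, pp. 36–37] [cite: VoisinHodgeI2002, §6.1.3 Cor. 6.14] -/
theorem eigenPiece_one_zero_eq_bot (hHD : exists_isReal_hodgeModel) (hI : hodgePQ_independent_of_hodgeModel)
    (hA : Motives.IsSmoothProjective g A) (σ : K →+* ℂ)
    (h01 : ∀ v ∈ ⨅ a : K, Module.End.eigenspace (θ a) (σ a), IsOfHodgeType g A 1 0 1 v) :
    (cmEndAction θ hθ hHD hI hA).eigenPiece σ 1 0 = ⊥ := by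
  rw [eq_bot_iff]
  intro t ht
  rw [Motives.HodgeStructure.EndAction.mem_eigenPiece_iff] at ht
  have h1 : IsOfHodgeType g A 1 1 0 (ofRatClassBaseChange (Motives.ComplexPoints A) 1 t) :=
    (mem_hodge_piece_one_zero_iff hHD hI hA t).1 ht.1
  have h2 : IsOfHodgeType g A 1 0 1 (ofRatClassBaseChange (Motives.ComplexPoints A) 1 t) :=
    h01 _ (ofRatClassBaseChange_mem_eigenline θ hθ hHD hI hA σ
      ((Submodule.mem_iInf _).2 fun e ↦ Module.End.mem_eigenspace_iff.2 (ht.2 e)))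
  rw [Submodule.mem_bot]
  exact Submodule.disjoint_def.1
    (disjoint_hodge_piece hHD hA (k := 1) (p := 1) (q := 0) (p' := 0) (q' := 1) rfl rfl (by decide)) t
    ((mem_hodge_piece_iff hHD hI hA (k := 1) (p := 1) (q := 0) rfl t).2 h1)
    ((mem_hodge_piece_iff hHD hI hA (k := 1) (p := 0) (q := 1) rfl t).2 h2)

/-- **`dim_ℚ H¹(A(ℂ); ℚ) = [K : ℚ]`** from the recorded `dim_ℂ H¹(A(ℂ); ℂ) = [K : ℚ]` (clause of (iii))
and `β`. [cite: Shimura1998, §3.2, pp. 20–22] -/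
theorem finrank_bettiCohomology_one_eq (hA : Motives.IsSmoothProjective g A)
    (hrk : Module.finrank ℂ (complexBetti A 1) = Module.finrank ℚ K) :
    Module.finrank ℚ (bettiCohomology A 1) = Module.finrank ℚ K := by
  rw [finrank_bettiCohomology_eq hA 1, hrk]

/-- **Every ring integer acts on `H¹(A(ℂ); ℚ)` as a pull-back**: for `a ∈ 𝓞_K` the endomorphism
`f : A ⟶ A` inducing `θ(a)` on `H¹(A(ℂ); ℂ)` (hypothesis `IsInducedOnIntegers`) has rational
pull-back `f^* = (cmEndAction θ hθ hHD hI hA).ι a` (both have complexification `θ(a)`, and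
`H¹(ℚ) → H¹(ℂ)` is injective). Shimura §3.2 / Shimura–Taniyama §6: `ι(𝓞_K) ⊆ End(A)` acting on
`H¹(A, ℚ)` through the rational representation. [cite: Shimura1998, §3.2, pp. 20–22] -/
theorem exists_pull_eq_cmEndAction (hHD : exists_isReal_hodgeModel) (hI : hodgePQ_independent_of_hodgeModel)
    (hA : Motives.IsSmoothProjective g A) (a : 𝓞 K) :
    ∃ f : A ⟶ A, pull f 1 = (cmEndAction θ hθ hHD hI hA).ι (a : K) := by
  obtain ⟨f, hf⟩ := hθ a
  refine ⟨f, LinearMap.ext fun v ↦ ofRatClass_injective 1 ?_⟩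
  rw [cmEndAction_ι, ofRatClass_cmAction, ← hf]
  exact Motives.ofRatClass_map 1 (Motives.AlgPoints.mapContinuous (L := ℂ) f) v

end CMTypes

end BettiUniverse

end Literature.AlgebraicGeometry.HodgeTheory

end
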